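import Summits.AnomalousDissipation.AnomalousDissipation.Theorems.SawtoothPulseCascadeApproxAssembly

/-!
# The geometric `L²` envelope of the forced linearised response on the box `[5,8] × {2,…,7}`
(route `AnomalousDissipation/SawtoothPulseCascade`; helper for the crux ApproxSol58 =
stmt-AnomalousDissipation-19688: this is S1 `stub_responseL2Envelope` of the lead's reshape
`linear-response-lip` in explicit-hypothesis form, and the input of the registered `stub_responseL2`)

At the box point `P = ⟨γ, 1/4, 2, 1, ρN⟩` one has `N_j/δ_j = 4(2ρN)^j`, so the phase envelope of
`…ApproxAssembly.response_envelope_of_budget` is geometric: with `M₂ = max (3e^{σ⋆γ}) (2ρN)` (`< γ² − 3` by the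
drift-free window and `2ρN ≤ 14 < 22`) and `K = (96√π + 24√(2π)) γ`,
`√∫‖L(t)‖² ≤ K ν (j+1) M₂^{j+1}` for `t ≤ horizon` in phase `j`, for all `ν ≤ ν₀(A)` — `ν₀` being the smaller
of K2″'s threshold and the budget threshold `ν_b(A)` making `16π²νN_j²tHalf_j ≤ δ_j²` hold for all phases
`j ≤ J_{γ²−3}(ν) + A` (possible because `4ρN² < (γ²−3)²`).

* §1 box arithmetic; §2 the budget threshold; §3 locating the slot of a time `t ≤ horizon`; §4 the envelope.
-/

set_option linter.dupNamespace false

noncomputable section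

namespace Summit.AnomalousDissipation.AnomalousDissipation.Theorems.SawtoothPulseCascade.ApproxResponse

open Set MeasureTheory UnitAddTorus
open scoped ContDiff InnerProductSpace
open Literature.Analysis Literature.Analysis.FunctionSpaces Literature.Analysis.FluidPDE
open Literature.Analysis.FluidPDE.SawtoothCascade
open Literature.Analysis.FluidPDE.SawtoothCascade.CascadeParams
open Summit.AnomalousDissipation.AnomalousDissipation.Theorems.SawtoothPulseCascade.K2Classical

/-! ## §1 Box arithmetic at `P = ⟨γ, 1/4, 2, 1, ρN⟩` -/

/-- `N_j = ρN^j` at the box point. -/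
theorem box_N (γ : ℝ) (ρN j : ℕ) : ((⟨γ, 1 / 4, 2, 1, ρN⟩ : CascadeParams).N j : ℝ) = (ρN : ℝ) ^ j := by
  simp [CascadeParams.N]

/-- `δ_j = (1/4)/2^j` at the box point. -/
theorem box_δ (γ : ℝ) (ρN j : ℕ) : (⟨γ, 1 / 4, 2, 1, ρN⟩ : CascadeParams).δ j = (1 / 4) / (2 : ℝ) ^ j := by
  simp [CascadeParams.δ]

/-- `N_j ≠ 0` at the box point (`ρN ≠ 0`). -/
theorem box_N_ne_zero (γ : ℝ) {ρN : ℕ} (hρ : ρN ≠ 0) (j : ℕ) : (⟨γ, 1 / 4, 2, 1, ρN⟩ : CascadeParams).N j ≠ 0 := by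
  simp [CascadeParams.N, hρ]

/-- `N_j/δ_j = 4(2ρN)^j`. -/
theorem box_N_div_δ (γ : ℝ) (ρN j : ℕ) :
    ((⟨γ, 1 / 4, 2, 1, ρN⟩ : CascadeParams).N j : ℝ) / (⟨γ, 1 / 4, 2, 1, ρN⟩ : CascadeParams).δ j =
      4 * (2 * (ρN : ℝ)) ^ j := by
  rw [box_N, box_δ, mul_pow]
  have h2 : (2 : ℝ) ^ j ≠ 0 := pow_ne_zero _ two_ne_zero
  field_simp

/-- **Geometric bound of the phase envelope at the box point.**  With `C₁ ≥ 0`, `M = max C₁ (2ρN)` (`ρN ≥ 1`),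
`ν, γ ≥ 0`: the right-hand side of `response_envelope_of_budget` on slot `k` is at most
`(96√π + 24√(2π)) γ ν (k/2 + 1) M^{k/2+1}`. -/
theorem box_sum_le (γ : ℝ) (hγ : 0 ≤ γ) {ρN : ℕ} (hρ : 1 ≤ ρN) {ν C₁ : ℝ} (hν : 0 ≤ ν) (hC₁ : 0 ≤ C₁) (k : ℕ) :
    ∑ i ∈ Finset.range k, C₁ ^ (k / 2 + 1 - i / 2) *
        (12 * Real.sqrt Real.pi * ν * γ * ((⟨γ, 1 / 4, 2, 1, ρN⟩ : CascadeParams).N (i / 2)) /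
          (⟨γ, 1 / 4, 2, 1, ρN⟩ : CascadeParams).δ (i / 2)) +
      6 * Real.sqrt (2 * Real.pi) * ν * ((⟨γ, 1 / 4, 2, 1, ρN⟩ : CascadeParams).N (k / 2)) * γ /
        (⟨γ, 1 / 4, 2, 1, ρN⟩ : CascadeParams).δ (k / 2) ≤
      (96 * Real.sqrt Real.pi + 24 * Real.sqrt (2 * Real.pi)) * γ * ν * ((k / 2 : ℕ) + 1) *
        (max C₁ (2 * ρN)) ^ (k / 2 + 1) := by
  set M : ℝ := max C₁ (2 * ρN) with hM
  have hρ' : (1 : ℝ) ≤ ρN := by exact_mod_cast hρ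
  have hM1 : 1 ≤ M := le_max_of_le_right (by linarith)
  have hM0 : 0 ≤ M := le_trans zero_le_one hM1
  have hC₁M : C₁ ≤ M := le_max_left _ _
  have h2ρM : 2 * (ρN : ℝ) ≤ M := le_max_right _ _
  have hsπ : 0 ≤ Real.sqrt Real.pi := Real.sqrt_nonneg _
  have hs2π : 0 ≤ Real.sqrt (2 * Real.pi) := Real.sqrt_nonneg _
  -- each summand ≤ 48 √π ν γ M^{k/2+1}
  have hterm : ∀ i ∈ Finset.range k, C₁ ^ (k / 2 + 1 - i / 2) *
      (12 * Real.sqrt Real.pi * ν * γ * ((⟨γ, 1 / 4, 2, 1, ρN⟩ : CascadeParams).N (i / 2)) /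
        (⟨γ, 1 / 4, 2, 1, ρN⟩ : CascadeParams).δ (i / 2)) ≤ 48 * Real.sqrt Real.pi * ν * γ * M ^ (k / 2 + 1) := by
    intro i hi
    have hi' : i < k := Finset.mem_range.1 hi
    have hexp : k / 2 + 1 - i / 2 + i / 2 = k / 2 + 1 := by omega
    rw [mul_div_assoc, box_N_div_δ]
    calc C₁ ^ (k / 2 + 1 - i / 2) * (12 * Real.sqrt Real.pi * ν * γ * (4 * (2 * (ρN : ℝ)) ^ (i / 2)))
        = 48 * Real.sqrt Real.pi * ν * γ * (C₁ ^ (k / 2 + 1 - i / 2) * (2 * (ρN : ℝ)) ^ (i / 2)) := by ring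
      _ ≤ 48 * Real.sqrt Real.pi * ν * γ * (M ^ (k / 2 + 1 - i / 2) * M ^ (i / 2)) := by
          refine mul_le_mul_of_nonneg_left ?_ (by positivity)
          exact mul_le_mul (pow_le_pow_left₀ hC₁ hC₁M _) (pow_le_pow_left₀ (by positivity) h2ρM _)
            (by positivity) (pow_nonneg hM0 _)
      _ = 48 * Real.sqrt Real.pi * ν * γ * M ^ (k / 2 + 1) := by rw [← pow_add, hexp]
  have hsum : ∑ i ∈ Finset.range k, C₁ ^ (k / 2 + 1 - i / 2) *
      (12 * Real.sqrt Real.pi * ν * γ * ((⟨γ, 1 / 4, 2, 1, ρN⟩ : CascadeParams).N (i / 2)) /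
        (⟨γ, 1 / 4, 2, 1, ρN⟩ : CascadeParams).δ (i / 2)) ≤ k * (48 * Real.sqrt Real.pi * ν * γ * M ^ (k / 2 + 1)) := by
    have h := Finset.sum_le_sum hterm
    rwa [Finset.sum_const, Finset.card_range, nsmul_eq_mul] at h
  have hlast : 6 * Real.sqrt (2 * Real.pi) * ν * ((⟨γ, 1 / 4, 2, 1, ρN⟩ : CascadeParams).N (k / 2)) * γ /
      (⟨γ, 1 / 4, 2, 1, ρN⟩ : CascadeParams).δ (k / 2) ≤ 24 * Real.sqrt (2 * Real.pi) * ν * γ * M ^ (k / 2 + 1) := by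
    have h1 : 6 * Real.sqrt (2 * Real.pi) * ν * ((⟨γ, 1 / 4, 2, 1, ρN⟩ : CascadeParams).N (k / 2)) * γ /
        (⟨γ, 1 / 4, 2, 1, ρN⟩ : CascadeParams).δ (k / 2) =
        6 * Real.sqrt (2 * Real.pi) * ν * γ * (((⟨γ, 1 / 4, 2, 1, ρN⟩ : CascadeParams).N (k / 2) : ℝ) /
          (⟨γ, 1 / 4, 2, 1, ρN⟩ : CascadeParams).δ (k / 2)) := by ring
    rw [h1, box_N_div_δ]
    have hp : (2 * (ρN : ℝ)) ^ (k / 2) ≤ M ^ (k / 2 + 1) :=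
      (pow_le_pow_left₀ (by positivity) h2ρM _).trans (pow_le_pow_right₀ hM1 (Nat.le_succ _))
    calc 6 * Real.sqrt (2 * Real.pi) * ν * γ * (4 * (2 * (ρN : ℝ)) ^ (k / 2))
        = 24 * Real.sqrt (2 * Real.pi) * ν * γ * (2 * (ρN : ℝ)) ^ (k / 2) := by ring
      _ ≤ 24 * Real.sqrt (2 * Real.pi) * ν * γ * M ^ (k / 2 + 1) := mul_le_mul_of_nonneg_left hp (by positivity)
  have hk2 : (k : ℝ) ≤ 2 * (((k / 2 : ℕ) : ℝ) + 1) := by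
    have : k ≤ 2 * (k / 2 + 1) := by omega
    exact_mod_cast this
  have hj1 : (1 : ℝ) ≤ ((k / 2 : ℕ) : ℝ) + 1 := by
    have : (0 : ℝ) ≤ ((k / 2 : ℕ) : ℝ) := Nat.cast_nonneg _
    linarith
  have hX : 0 ≤ 48 * Real.sqrt Real.pi * ν * γ * M ^ (k / 2 + 1) := by positivity
  have hY : 0 ≤ 24 * Real.sqrt (2 * Real.pi) * ν * γ * M ^ (k / 2 + 1) := by positivity
  calc _ ≤ k * (48 * Real.sqrt Real.pi * ν * γ * M ^ (k / 2 + 1)) + 24 * Real.sqrt (2 * Real.pi) * ν * γ * M ^ (k / 2 + 1) :=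
        add_le_add hsum hlast
    _ ≤ 2 * (((k / 2 : ℕ) : ℝ) + 1) * (48 * Real.sqrt Real.pi * ν * γ * M ^ (k / 2 + 1)) +
          (((k / 2 : ℕ) : ℝ) + 1) * (24 * Real.sqrt (2 * Real.pi) * ν * γ * M ^ (k / 2 + 1)) := by
        nlinarith
    _ = (96 * Real.sqrt Real.pi + 24 * Real.sqrt (2 * Real.pi)) * γ * ν * (((k / 2 : ℕ) : ℝ) + 1) * M ^ (k / 2 + 1) := by
        ring


/-! ## §2 The budget threshold `ν_b(A)` -/

/-- `tHalf j ≤ 45/π⁴`. -/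
theorem tHalf_le (j : ℕ) : tHalf j ≤ 45 / Real.pi ^ 4 := by
  unfold tHalf
  have hπ : 0 < Real.pi ^ 4 := by positivity
  have hj : (1 : ℝ) ≤ ((j : ℝ) + 1) ^ 4 := one_le_pow₀ (by
    have : (0 : ℝ) ≤ j := Nat.cast_nonneg j
    linarith)
  exact div_le_div_of_nonneg_left (by norm_num) hπ (le_mul_of_one_le_right hπ.le hj)

/-- **The exponent bookkeeping behind the budget.**  For `q ≥ 1`, `r > 1` with `q < r²` and `0 < ν ≤ 1`:
`ν · q^{J_r(ν)} ≤ q · ν^{1 − log q/(2 log r)}` where `J_r(ν) = ⌈log(1/ν)/(2 log r)⌉₊` (`Jrate`). -/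
theorem mul_pow_Jrate_le {q r ν : ℝ} (hq : 1 ≤ q) (hr : 1 < r) (hν : 0 < ν) (hν1 : ν ≤ 1) :
    ν * q ^ Jrate r ν ≤ q * ν ^ (1 - Real.log q / (2 * Real.log r)) := by
  have hq0 : 0 < q := by linarith
  have hlogr : 0 < Real.log r := Real.log_pos hr
  set L : ℝ := Real.log (1 / ν) / (2 * Real.log r) with hL
  have hL0 : 0 ≤ L := by
    rw [hL]
    exact div_nonneg (Real.log_nonneg (by rw [le_div_iff₀ hν]; linarith)) (by positivity)
  have hceil : ((Jrate r ν : ℕ) : ℝ) ≤ L + 1 := by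
    unfold Jrate
    exact (Nat.ceil_lt_add_one hL0).le
  -- `q^{Jrate} ≤ q^{L+1} = q · q^L`
  have h1 : q ^ Jrate r ν ≤ q * q ^ L := by
    calc q ^ Jrate r ν = q ^ ((Jrate r ν : ℕ) : ℝ) := (Real.rpow_natCast q _).symm
      _ ≤ q ^ (L + 1) := Real.rpow_le_rpow_of_exponent_le hq hceil
      _ = q * q ^ L := by rw [Real.rpow_add hq0, Real.rpow_one, mul_comm]
  -- `q^L = ν^{-θ}`
  have h2 : q ^ L = ν ^ (-(Real.log q / (2 * Real.log r))) := by
    rw [Real.rpow_def_of_pos hq0, Real.rpow_def_of_pos hν, hL, one_div, Real.log_inv]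
    congr 1
    field_simp
  calc ν * q ^ Jrate r ν ≤ ν * (q * q ^ L) := mul_le_mul_of_nonneg_left h1 hν.le
    _ = q * (ν ^ (1 : ℝ) * ν ^ (-(Real.log q / (2 * Real.log r)))) := by rw [h2, Real.rpow_one]; ring
    _ = q * ν ^ (1 - Real.log q / (2 * Real.log r)) := by rw [← Real.rpow_add hν]; rfl

/-- **The budget threshold.**  For `(γ, ρN)` in the box and every lag `A` there is `ν_b > 0` such that for all
`ν ∈ (0, ν_b]` and all phases `j ≤ J_{γ²−3}(ν) + A` the (halved) analyticity budget
`16π² ν N_j² tHalf_j ≤ δ_j²` holds at `P = ⟨γ, 1/4, 2, 1, ρN⟩`. -/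
theorem budget_threshold {γ : ℝ} (hγ : γ ∈ Icc (5 : ℝ) 8) {ρN : ℕ} (hρN : ρN ∈ Finset.Icc 2 7) (A : ℕ) :
    ∃ νb : ℝ, 0 < νb ∧ ∀ ν ∈ Ioc 0 νb, ∀ j ≤ Jrate (γ ^ 2 - 3) ν + A,
      16 * Real.pi ^ 2 * ν * (((⟨γ, 1 / 4, 2, 1, ρN⟩ : CascadeParams).N j : ℕ) : ℝ) ^ 2 * tHalf j ≤
        (⟨γ, 1 / 4, 2, 1, ρN⟩ : CascadeParams).δ j ^ 2 := by
  obtain ⟨hρ2, hρ7⟩ := Finset.mem_Icc.1 hρN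
  have hρ2' : (2 : ℝ) ≤ ρN := by exact_mod_cast hρ2
  have hρ7' : (ρN : ℝ) ≤ 7 := by exact_mod_cast hρ7
  set r : ℝ := γ ^ 2 - 3 with hr
  set q : ℝ := 4 * (ρN : ℝ) ^ 2 with hq
  have hr22 : 22 ≤ r := by rw [hr]; nlinarith [hγ.1]
  have hr1 : 1 < r := by linarith
  have hq1 : 1 ≤ q := by rw [hq]; nlinarith
  have hq0 : 0 < q := by linarith
  have hqr : q < r ^ 2 := by rw [hq]; nlinarith
  set θ : ℝ := Real.log q / (2 * Real.log r) with hθ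
  have hlogr : 0 < Real.log r := Real.log_pos hr1
  have hθ1 : θ < 1 := by
    rw [hθ, div_lt_one (by positivity)]
    have h2 : 2 * Real.log r = Real.log (r ^ 2) := by rw [Real.log_pow]; norm_num
    rw [h2]
    exact Real.log_lt_log hq0 hqr
  have hθ0 : 0 ≤ θ := div_nonneg (Real.log_nonneg hq1) (by positivity)
  have h1θ : 0 < 1 - θ := by linarith
  set c : ℝ := 1 / (1300 * q ^ (A + 1)) with hc
  have hc0 : 0 < c := by rw [hc]; positivity
  set νb : ℝ := min 1 (c ^ (1 / (1 - θ))) with hνb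
  have hνb0 : 0 < νb := lt_min one_pos (Real.rpow_pos_of_pos hc0 _)
  refine ⟨νb, hνb0, fun ν hν j hj => ?_⟩
  have hν0 : 0 < ν := hν.1
  have hν1 : ν ≤ 1 := hν.2.trans (min_le_left _ _)
  have hνc : ν ≤ c ^ (1 / (1 - θ)) := hν.2.trans (min_le_right _ _)
  -- Step 1: `ν q^j ≤ 1/1300`
  have hA : ν * q ^ j ≤ 1 / 1300 := by
    have hj' : q ^ j ≤ q ^ A * q ^ Jrate r ν := by
      rw [← pow_add]; exact pow_le_pow_right₀ hq1 (by omega)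
    have hpow : ν ^ (1 - θ) ≤ c := by
      calc ν ^ (1 - θ) ≤ (c ^ (1 / (1 - θ))) ^ (1 - θ) := Real.rpow_le_rpow hν0.le hνc h1θ.le
        _ = c := by rw [one_div, Real.rpow_inv_rpow hc0.le h1θ.ne']
    calc ν * q ^ j ≤ ν * (q ^ A * q ^ Jrate r ν) := mul_le_mul_of_nonneg_left hj' hν0.le
      _ = q ^ A * (ν * q ^ Jrate r ν) := by ring
      _ ≤ q ^ A * (q * ν ^ (1 - θ)) := mul_le_mul_of_nonneg_left (mul_pow_Jrate_le hq1 hr1 hν0 hν1) (by positivity)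
      _ ≤ q ^ A * (q * c) := by gcongr
      _ = 1 / 1300 := by rw [hc]; field_simp; ring
  -- Step 2: unfold the budget at the box point
  rw [box_N, box_δ]
  have hπ3 : 3 < Real.pi := Real.pi_gt_three
  have hπ4 : 0 < Real.pi ^ 4 := by positivity
  have hth := tHalf_le j
  have hρN2j : ((ρN : ℝ) ^ j) ^ 2 = ((ρN : ℝ) ^ 2) ^ j := by ring
  have hqj : q ^ j = 4 ^ j * ((ρN : ℝ) ^ 2) ^ j := by rw [hq, mul_pow]
  have h4j : (0 : ℝ) < 4 ^ j := by positivity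
  have h2j : ((1 / 4) / (2 : ℝ) ^ j) ^ 2 = 1 / (16 * 4 ^ j) := by
    rw [div_pow, div_pow, ← pow_mul, show (2 : ℝ) ^ (j * 2) = 4 ^ j by rw [mul_comm, pow_mul]; norm_num]
    field_simp
    ring
  rw [h2j, hρN2j]
  -- `16π²ν (ρN²)^j tHalf_j ≤ 16π²ν(ρN²)^j·45/π⁴ = 720 ν (ρN²)^j/π²` and `ν (ρN²)^j = ν q^j/4^j ≤ 1/(1300·4^j)`
  have hνρ : ν * ((ρN : ℝ) ^ 2) ^ j ≤ 1 / (1300 * 4 ^ j) := by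
    have : ν * ((ρN : ℝ) ^ 2) ^ j = ν * q ^ j / 4 ^ j := by rw [hqj]; field_simp
    rw [this, show (1 : ℝ) / (1300 * 4 ^ j) = (1 / 1300) / 4 ^ j by rw [div_div]]
    exact div_le_div_of_nonneg_right hA h4j.le
  have hπ2 : 9 < Real.pi ^ 2 := by nlinarith
  calc 16 * Real.pi ^ 2 * ν * ((ρN : ℝ) ^ 2) ^ j * tHalf j
      ≤ 16 * Real.pi ^ 2 * ν * ((ρN : ℝ) ^ 2) ^ j * (45 / Real.pi ^ 4) :=
        mul_le_mul_of_nonneg_left hth (by positivity)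
    _ = 720 * (ν * ((ρN : ℝ) ^ 2) ^ j) / Real.pi ^ 2 := by field_simp; ring
    _ ≤ 720 * (1 / (1300 * 4 ^ j)) / Real.pi ^ 2 := by gcongr
    _ ≤ 1 / (16 * 4 ^ j) := by
        rw [div_le_div_iff₀ (by positivity) (by positivity)]
        have e1 : 720 * (1 / (1300 * (4 : ℝ) ^ j)) * (16 * 4 ^ j) = 720 * 16 / 1300 := by
          field_simp
        rw [e1]
        nlinarith [hπ2]

end Summit.AnomalousDissipation.AnomalousDissipation.Theorems.SawtoothPulseCascade.ApproxResponse

end
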